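import Mathlib
import Literature.MathematicalPhysics.QuantumFieldTheory.WilsonFlow
import Literature.MathematicalPhysics.QuantumFieldTheory.Luscher2010.TrivializingMaps

/-!
# Lüscher 2010 §3.1 — flows on `SU(n)^E`, I: local existence and invariance (towards `FlowGlobalExistence`)

M. Lüscher, *Trivializing maps, the Wilson flow and the HMC algorithm*, Commun. Math. Phys. 293 (2010)
899–919 [Luscher2010Trivializing], §3.1 (paragraph after eq. (3.3), citing Arnold, *Ordinary differential
equations*, §35): "If `Z_t(U)` is a differentiable function of `t` and `U`, the flow equation (3.2) has a
unique solution `U_t` for any specified initial value `U_0 = V` and all `t ∈ (-∞,∞)` … the existence of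
the solution for all times … can only be guaranteed, without further assumptions, because the field
manifold is compact."  File A of the Lüscher typing (`Luscher2010/TrivializingMaps.lean`) records this as
the cited `Prop` `FlowGlobalExistence d L n`; this file and its companion `TrivializingMaps/FlowExistence.lean`
PROVE it (`flowGlobalExistence_holds`, there), for every `d`, `L ≥ 1`, `n`, by running the tree's rigorous
Wilson-flow construction (`WilsonFlow.lean`: smooth cut-off, Picard–Lindelöf on `[-T, T]`, invariance of
`SU(n)` by Liouville's formula, patching in `T`, Grönwall) for a GENERAL time-dependent `C¹` tangent
generator.  THIS FILE: the local theory (projected cut-off field, Picard–Lindelöf on `[-T, T]`, invariance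
of the field manifold, the true flow equation along the local flow).  Outline of the whole proof:

* the generator is first projected onto `𝔰𝔲(n)` linkwise (`vfZ Z t W e = 𝒫(Z_t(W)(e)) · W(e)`): on the
  field manifold this is the flow equation itself (tangency), and off it the projection keeps the
  invariance argument `mem_SU_of_ode` available;
* a smooth cut-off in time AND in the field (`vfCutZ`) makes the field globally Lipschitz and bounded on
  `ℝ × M_n(ℂ)^E` (a `C¹` map with compact support), so Mathlib's `IsPicardLindelof` applies on every
  `[-T, T]` and from every initial point of the ball containing `SU(n)^E`;
* the local solutions stay in `SU(n)^E`, where all cut-offs are inactive, so they solve the TRUE flow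
  equation; uniqueness patches them into a global flow map `flowMap Z`, jointly continuous in `(t, V)`
  (Lipschitz dependence on the initial point), and Grönwall on a ball containing any given flow line
  gives uniqueness among ALL ambient solutions started on the manifold.

Authored by the pub-lqcd lean-1 seat (cell lqcd-flow, FANOUT row 30): OUR formalisation of the
published (textbook) proof behind file A's cited statement (venture placement: new Lean work of the cell;
the cited statement itself stays in `Literature/…/Luscher2010/TrivializingMaps.lean`); it makes theory-1's
`TrivializingMaps/DefectLogWeightMeasure.lean` (`defectControlsLogWeight_of : FlowGlobalExistence →
JacobianFormula → DefectControlsLogWeight`) conditional on the Jacobian formula (3.9) alone.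

HONEST FRAMING: exact (Metropolis-corrected) sampling algorithms for lattice gauge theory; figures
of merit are autocorrelation/cost numbers at stated couplings and volumes; no continuum-physics claim.
-/

noncomputable section

open Set Metric Filter Function
open scoped Matrix Topology NNReal

namespace Summit.Ventures.LatticeQCDFlow.TrivializingMaps

open Literature.MathematicalPhysics.QuantumFieldTheory
  Literature.MathematicalPhysics.QuantumFieldTheory.Luscher2010 WilsonFlow

variable {d L n : ℕ}

namespace FlowExistence

open scoped Matrix.Norms.Frobenius

/-! ### The projected field and its cut-off -/

/-- The generator's flow field with the generator projected linkwise onto `𝔰𝔲(n)`: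
`vfZ Z t W e = 𝒫(Z_t(W)(e)) · W(e)`.  On `SU(n)^E` (where `Z` is tangent) this is the right-hand side
`Z_t(U) U` of the flow equation (3.2). [cite: Luscher2010Trivializing, §3.1 eq. (3.2)] -/
def vfZ (Z : Generator d L n) (t : ℝ) (W : AmbConfig d L n) : AmbConfig d L n :=
  fun e => suProj (Z t W e) * W e

/-- `vfZ` evaluated at a link. [folklore] -/
theorem vfZ_apply (Z : Generator d L n) (t : ℝ) (W : AmbConfig d L n) (e : Edge d L) :
    vfZ Z t W e = suProj (Z t W e) * W e := rfl

/-- On the field manifold the projection is inactive: `vfZ Z t U e = Z_t(U)(e) · U(e)` for a tangent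
generator. [cite: Luscher2010Trivializing, §3.1] -/
theorem vfZ_coeConfig {Z : Generator d L n} (hZt : Z.IsTangent) (t : ℝ) (U : GaugeConfig d L (Matrix.specialUnitaryGroup (Fin n) ℂ))
    (e : Edge d L) : vfZ Z t (coeConfig U) e = Z t (coeConfig U) e * coeConfig U e := by
  have h := (mem_suAlgebra_iff _).1 (hZt t U e)
  rw [vfZ_apply, suProj_eq_self h.1 h.2]

/-- The smooth time cut-off `ψ_T(t) = smoothTransition ((T+1)² + 1 − t²)`: equal to `1` for `|t| ≤ T + 1`
and to `0` for `|t| ≥ T + 2`. [folklore] -/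
def tcut (T : ℝ≥0) (t : ℝ) : ℝ := Real.smoothTransition (((T : ℝ) + 1) ^ 2 + 1 - t ^ 2)

/-- The time cut-off is `C^∞`. [folklore] -/
theorem contDiff_tcut (T : ℝ≥0) {m : ℕ∞} : ContDiff ℝ m (tcut T) := by
  unfold tcut
  exact Real.smoothTransition.contDiff.comp ((contDiff_const.add contDiff_const).sub (contDiff_id.pow 2))

/-- The time cut-off is `1` on `[-(T+1), T+1]`. [folklore] -/
theorem tcut_eq_one {T : ℝ≥0} {t : ℝ} (ht : |t| ≤ (T : ℝ) + 1) : tcut T t = 1 := by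
  refine Real.smoothTransition.one_of_one_le ?_
  have h1 : |t| ^ 2 ≤ ((T : ℝ) + 1) ^ 2 := pow_le_pow_left₀ (abs_nonneg t) ht 2
  rw [sq_abs] at h1
  linarith

/-- The time cut-off vanishes for `|t| ≥ T + 2`. [folklore] -/
theorem tcut_eq_zero {T : ℝ≥0} {t : ℝ} (ht : (T : ℝ) + 2 ≤ |t|) : tcut T t = 0 := by
  refine Real.smoothTransition.zero_of_nonpos ?_
  have hT : (0 : ℝ) ≤ T := T.coe_nonneg
  have h1 : ((T : ℝ) + 2) ^ 2 ≤ |t| ^ 2 := pow_le_pow_left₀ (by linarith) ht 2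
  rw [sq_abs] at h1
  nlinarith

variable [NeZero L]

/-- The cut-off field `(ψ_T(t) χ(W)) • vfZ Z t W` (time cut-off `ψ_T`, field cut-off `χ` of
`WilsonFlow.cutoff`): a `C¹` field with compact support in `(t, W)`, equal to `vfZ` for `|t| ≤ T + 1` near
`SU(n)^E`. [folklore] -/
def vfCutZ (Z : Generator d L n) (T : ℝ≥0) (t : ℝ) (W : AmbConfig d L n) : AmbConfig d L n :=
  (tcut T t * cutoff W) • vfZ Z t W

/-- `vfCutZ` at a link: `((ψ χ) • 𝒫 Z_t(W)(e)) · W(e)`. [folklore] -/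
theorem vfCutZ_apply (Z : Generator d L n) (T : ℝ≥0) (t : ℝ) (W : AmbConfig d L n) (e : Edge d L) :
    vfCutZ Z T t W e = ((tcut T t * cutoff W) • suProj (Z t W e)) * W e := by
  rw [vfCutZ, Pi.smul_apply, vfZ_apply, smul_mul_assoc]

/-- For `|t| ≤ T + 1` the time cut-off is inactive. [folklore] -/
theorem vfCutZ_eq_of_abs_le (Z : Generator d L n) {T : ℝ≥0} {t : ℝ} (ht : |t| ≤ (T : ℝ) + 1)
    (W : AmbConfig d L n) : vfCutZ Z T t W = cutoff W • vfZ Z t W := by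
  rw [vfCutZ, tcut_eq_one ht, one_mul]

/-- On `SU(n)^E` and for `|t| ≤ T + 1` both cut-offs are inactive. [folklore] -/
theorem vfCutZ_coeConfig (Z : Generator d L n) {T : ℝ≥0} {t : ℝ} (ht : |t| ≤ (T : ℝ) + 1)
    (U : GaugeConfig d L (Matrix.specialUnitaryGroup (Fin n) ℂ)) : vfCutZ Z T t (coeConfig U) = vfZ Z t (coeConfig U) := by
  rw [vfCutZ_eq_of_abs_le Z ht,
    cutoff_eq_one ((sqNorm_coeConfig_le U).trans (le_add_of_nonneg_right zero_le_one)), one_smul]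

variable {Z : Generator d L n}

/-- The projected field is `C¹` jointly in `(t, W)` when the generator is. [folklore] -/
theorem contDiff_vfZ (hZ : ContDiff ℝ 1 (fun p : ℝ × AmbConfig d L n => Z p.1 p.2)) :
    ContDiff ℝ 1 (fun p : ℝ × AmbConfig d L n => vfZ Z p.1 p.2) := by
  refine contDiff_pi.2 fun e => ?_
  have h1 : ContDiff ℝ 1 (fun p : ℝ × AmbConfig d L n => Z p.1 p.2 e) := (contDiff_eval e).comp hZ
  have h2 : ContDiff ℝ 1 (fun p : ℝ × AmbConfig d L n => p.2 e) := (contDiff_eval e).comp contDiff_snd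
  exact (contDiff_suProj.comp h1).mul h2

/-- The scalar cut-off `(t, W) ↦ ψ_T(t) χ(W)` is `C¹`. [folklore] -/
theorem contDiff_scalarCut (T : ℝ≥0) :
    ContDiff ℝ 1 (fun p : ℝ × AmbConfig d L n => tcut T p.1 * cutoff p.2) :=
  ((contDiff_tcut T (m := 1)).comp contDiff_fst).mul ((contDiff_cutoff (m := 1)).comp contDiff_snd)

/-- The scalar cut-off has compact support in `ℝ × M_n(ℂ)^E`. [folklore] -/
theorem hasCompactSupport_scalarCut (T : ℝ≥0) :
    HasCompactSupport (fun p : ℝ × AmbConfig d L n => tcut T p.1 * cutoff p.2) := by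
  refine HasCompactSupport.intro ((isCompact_closedBall (0 : ℝ) ((T : ℝ) + 2)).prod
    (isCompact_closedBall (0 : AmbConfig d L n) (√(qmax d L n + 2)))) fun p hp => ?_
  rw [Set.mem_prod, not_and_or] at hp
  rcases hp with h1 | h2
  · rw [mem_closedBall, dist_zero_right, Real.norm_eq_abs, not_le] at h1
    rw [tcut_eq_zero h1.le, zero_mul]
  · rw [mem_closedBall, dist_zero_right, not_le] at h2
    have h := h2.trans_le (norm_le_sqrt_sqNorm p.2)
    have hq : 0 ≤ qmax d L n + 2 := by unfold qmax; positivity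
    rw [cutoff_eq_zero ((Real.sqrt_lt_sqrt_iff hq).1 h).le, mul_zero]

/-- The cut-off field is `C¹` on `ℝ × M_n(ℂ)^E`. [folklore] -/
theorem contDiff_vfCutZ (hZ : ContDiff ℝ 1 (fun p : ℝ × AmbConfig d L n => Z p.1 p.2)) (T : ℝ≥0) :
    ContDiff ℝ 1 (fun p : ℝ × AmbConfig d L n => vfCutZ Z T p.1 p.2) :=
  (contDiff_scalarCut T).smul (contDiff_vfZ hZ)

/-- The cut-off field has compact support in `ℝ × M_n(ℂ)^E`. [folklore] -/
theorem hasCompactSupport_vfCutZ (Z : Generator d L n) (T : ℝ≥0) :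
    HasCompactSupport (fun p : ℝ × AmbConfig d L n => vfCutZ Z T p.1 p.2) :=
  (hasCompactSupport_scalarCut (d := d) (L := L) (n := n) T).smul_right
    (f' := fun p : ℝ × AmbConfig d L n => vfZ Z p.1 p.2)

/-- The cut-off field is globally Lipschitz on `ℝ × M_n(ℂ)^E`. [folklore] -/
theorem exists_lipschitzWith_vfCutZ (hZ : ContDiff ℝ 1 (fun p : ℝ × AmbConfig d L n => Z p.1 p.2))
    (T : ℝ≥0) : ∃ K, LipschitzWith K (fun p : ℝ × AmbConfig d L n => vfCutZ Z T p.1 p.2) :=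
  ContDiff.lipschitzWith_of_hasCompactSupport (hasCompactSupport_vfCutZ Z T) (contDiff_vfCutZ hZ T)
    one_ne_zero

/-- The cut-off field is bounded. [folklore] -/
theorem exists_bound_vfCutZ (hZ : ContDiff ℝ 1 (fun p : ℝ × AmbConfig d L n => Z p.1 p.2))
    (T : ℝ≥0) : ∃ C : ℝ≥0, ∀ t W, ‖vfCutZ Z T t W‖ ≤ C := by
  obtain ⟨C, hC⟩ := (contDiff_vfCutZ hZ T).continuous.bounded_above_of_compact_support
    (hasCompactSupport_vfCutZ Z T)
  exact ⟨⟨max C 0, le_max_right _ _⟩, fun t W => (hC (t, W)).trans (le_max_left _ _)⟩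

/-! ### Picard–Lindelöf on `[-T, T]` -/

/-- The Picard–Lindelöf hypotheses for the cut-off field on `[-T, T]`, for all initial points of
`closedBall 0 ρ₀ ⊇ SU(n)^E`. [folklore] -/
theorem exists_isPicardLindelof (hZ : ContDiff ℝ 1 (fun p : ℝ × AmbConfig d L n => Z p.1 p.2))
    (T : ℝ≥0) : ∃ C K : ℝ≥0,
      IsPicardLindelof (vfCutZ Z T) (tmin := -(T : ℝ)) (tmax := T) ⟨0, zero_mem_Icc T⟩ 0
        (ρ₀ d L n + C * T) (ρ₀ d L n) C K := by
  obtain ⟨K, hK⟩ := exists_lipschitzWith_vfCutZ hZ T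
  obtain ⟨C, hC⟩ := exists_bound_vfCutZ hZ T
  refine ⟨C, K, ?_, ?_, ?_, ?_⟩
  · intro t _
    refine (LipschitzWith.of_dist_le_mul fun x y => ?_).lipschitzOnWith
    have h := hK.dist_le_mul (t, x) (t, y)
    rwa [Prod.dist_eq, dist_self, max_eq_right dist_nonneg] at h
  · intro x _
    exact ((contDiff_vfCutZ hZ T).continuous.comp (Continuous.prodMk_left x)).continuousOn
  · intro t _ x _
    exact hC t x
  · have hmax : max ((T : ℝ) - 0) (0 - -(T : ℝ)) = T := by simp
    rw [hmax]
    push_cast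
    linarith

/-- Local flows of the cut-off field on `[-T, T]` exist from every point of `closedBall 0 ρ₀`, Lipschitz in
the initial point (Mathlib's Picard–Lindelöf). [folklore] -/
theorem exists_localFlow (hZ : ContDiff ℝ 1 (fun p : ℝ × AmbConfig d L n => Z p.1 p.2)) (T : ℝ≥0) :
    ∃ α : AmbConfig d L n → ℝ → AmbConfig d L n,
      (∀ x ∈ closedBall (0 : AmbConfig d L n) (ρ₀ d L n), α x 0 = x ∧
        ∀ t ∈ Icc (-(T : ℝ)) T, HasDerivWithinAt (α x) (vfCutZ Z T t (α x t)) (Icc (-(T : ℝ)) T) t) ∧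
      ∃ L' : ℝ≥0, ∀ t ∈ Icc (-(T : ℝ)) T,
        LipschitzOnWith L' (α · t) (closedBall (0 : AmbConfig d L n) (ρ₀ d L n)) := by
  obtain ⟨C, K, hPL⟩ := exists_isPicardLindelof hZ T
  exact hPL.exists_forall_mem_closedBall_eq_hasDerivWithinAt_lipschitzOnWith

open scoped Classical in
/-- A chosen local flow of the cut-off field on `[-T, T]` (junk if no local flow with the specification of
`exists_localFlow` exists, which does not happen for a `C¹` generator). [folklore] -/
def localFlow (Z : Generator d L n) (T : ℝ≥0) : AmbConfig d L n → ℝ → AmbConfig d L n :=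
  if h : ∃ α : AmbConfig d L n → ℝ → AmbConfig d L n,
      (∀ x ∈ closedBall (0 : AmbConfig d L n) (ρ₀ d L n), α x 0 = x ∧
        ∀ t ∈ Icc (-(T : ℝ)) T, HasDerivWithinAt (α x) (vfCutZ Z T t (α x t)) (Icc (-(T : ℝ)) T) t) ∧
      ∃ L' : ℝ≥0, ∀ t ∈ Icc (-(T : ℝ)) T,
        LipschitzOnWith L' (α · t) (closedBall (0 : AmbConfig d L n) (ρ₀ d L n))
  then h.choose else fun x _ => x

/-- The chosen local flow satisfies its specification. [folklore] -/
theorem localFlow_spec (hZ : ContDiff ℝ 1 (fun p : ℝ × AmbConfig d L n => Z p.1 p.2)) (T : ℝ≥0) :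
    (∀ x ∈ closedBall (0 : AmbConfig d L n) (ρ₀ d L n), localFlow Z T x 0 = x ∧
        ∀ t ∈ Icc (-(T : ℝ)) T,
          HasDerivWithinAt (localFlow Z T x) (vfCutZ Z T t (localFlow Z T x t)) (Icc (-(T : ℝ)) T) t) ∧
      ∃ L' : ℝ≥0, ∀ t ∈ Icc (-(T : ℝ)) T,
        LipschitzOnWith L' (localFlow Z T · t) (closedBall (0 : AmbConfig d L n) (ρ₀ d L n)) := by
  have h := exists_localFlow hZ T
  have heq : localFlow Z T = h.choose := by
    unfold localFlow
    exact dif_pos h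
  rw [heq]
  exact h.choose_spec

/-- Initial condition of `localFlow`. [folklore] -/
theorem localFlow_zero (hZ : ContDiff ℝ 1 (fun p : ℝ × AmbConfig d L n => Z p.1 p.2)) (T : ℝ≥0)
    {x : AmbConfig d L n} (hx : x ∈ closedBall (0 : AmbConfig d L n) (ρ₀ d L n)) :
    localFlow Z T x 0 = x :=
  ((localFlow_spec hZ T).1 x hx).1

/-- `localFlow` solves the cut-off ODE on `[-T, T]`. [folklore] -/
theorem hasDerivWithinAt_localFlow (hZ : ContDiff ℝ 1 (fun p : ℝ × AmbConfig d L n => Z p.1 p.2))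
    (T : ℝ≥0) {x : AmbConfig d L n} (hx : x ∈ closedBall (0 : AmbConfig d L n) (ρ₀ d L n)) {t : ℝ}
    (ht : t ∈ Icc (-(T : ℝ)) T) :
    HasDerivWithinAt (localFlow Z T x) (vfCutZ Z T t (localFlow Z T x t)) (Icc (-(T : ℝ)) T) t :=
  ((localFlow_spec hZ T).1 x hx).2 t ht

/-- `localFlow` is Lipschitz in the initial point, uniformly on `[-T, T]`. [folklore] -/
theorem exists_lipschitzOnWith_localFlow
    (hZ : ContDiff ℝ 1 (fun p : ℝ × AmbConfig d L n => Z p.1 p.2)) (T : ℝ≥0) :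
    ∃ L' : ℝ≥0, ∀ t ∈ Icc (-(T : ℝ)) T,
      LipschitzOnWith L' (localFlow Z T · t) (closedBall (0 : AmbConfig d L n) (ρ₀ d L n)) :=
  (localFlow_spec hZ T).2

/-- **Invariance**: the local flow started on `SU(n)^E` stays in `SU(n)^E` on `[-T, T]` (the projected,
cut-off generator is anti-Hermitian and traceless linkwise; Liouville). [folklore] -/
theorem localFlow_mem_SU (hZ : ContDiff ℝ 1 (fun p : ℝ × AmbConfig d L n => Z p.1 p.2)) (T : ℝ≥0)
    (U : GaugeConfig d L (Matrix.specialUnitaryGroup (Fin n) ℂ)) {t : ℝ} (ht : t ∈ Icc (-(T : ℝ)) T) (e : Edge d L) :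
    localFlow Z T (coeConfig U) t e ∈ (Matrix.specialUnitaryGroup (Fin n) ℂ) := by
  refine mem_SU_of_ode (A := fun τ => localFlow Z T (coeConfig U) τ e)
    (X := fun τ => -((tcut T τ * cutoff (localFlow Z T (coeConfig U) τ)) •
      suProj (Z τ (localFlow Z T (coeConfig U) τ) e)))
    (zero_mem_Icc T) (fun τ hτ => ?_) (fun τ _ => ?_) (fun τ _ => ?_) ?_ t ht
  · have h := (hasDerivWithinAt_pi.1 (hasDerivWithinAt_localFlow hZ T (coeConfig_mem_closedBall U) hτ)) e
    rw [vfCutZ_apply] at h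
    rw [neg_neg]
    exact h
  · rw [Matrix.conjTranspose_neg, Matrix.conjTranspose_smul, conjTranspose_suProj, star_trivial, smul_neg,
      neg_neg]
  · rw [Matrix.trace_neg, Matrix.trace_smul, trace_suProj, smul_zero, neg_zero]
  · simp only [localFlow_zero hZ T (coeConfig_mem_closedBall U), coeConfig_apply]
    exact (U e).2

/-- The local flow at time `t ∈ [-T, T]` from an `SU(n)` configuration, as an `SU(n)` configuration. [folklore] -/
def localFlowSU (hZ : ContDiff ℝ 1 (fun p : ℝ × AmbConfig d L n => Z p.1 p.2)) (T : ℝ≥0)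
    (U : GaugeConfig d L (Matrix.specialUnitaryGroup (Fin n) ℂ)) (t : ℝ) (ht : t ∈ Icc (-(T : ℝ)) T) : GaugeConfig d L (Matrix.specialUnitaryGroup (Fin n) ℂ) :=
  fun e => ⟨localFlow Z T (coeConfig U) t e, localFlow_mem_SU hZ T U ht e⟩

/-- `localFlowSU` read in the ambient space is `localFlow`. [folklore] -/
theorem coeConfig_localFlowSU (hZ : ContDiff ℝ 1 (fun p : ℝ × AmbConfig d L n => Z p.1 p.2))
    (T : ℝ≥0) (U : GaugeConfig d L (Matrix.specialUnitaryGroup (Fin n) ℂ)) (t : ℝ) (ht : t ∈ Icc (-(T : ℝ)) T) :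
    coeConfig (localFlowSU hZ T U t ht) = localFlow Z T (coeConfig U) t := rfl

/-- Along the invariant manifold every cut-off and the projection are inactive: the local flow solves
the TRUE flow equation `U̇ = Z_t(U) U` on `[-T, T]`. [cite: Luscher2010Trivializing, §3.1 eq. (3.2)] -/
theorem hasDerivWithinAt_localFlow_true (hZ : ContDiff ℝ 1 (fun p : ℝ × AmbConfig d L n => Z p.1 p.2))
    (hZt : Z.IsTangent) (T : ℝ≥0) (U : GaugeConfig d L (Matrix.specialUnitaryGroup (Fin n) ℂ)) {t : ℝ} (ht : t ∈ Icc (-(T : ℝ)) T) :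
    HasDerivWithinAt (localFlow Z T (coeConfig U))
      (fun e => Z t (localFlow Z T (coeConfig U) t) e * localFlow Z T (coeConfig U) t e)
      (Icc (-(T : ℝ)) T) t := by
  have h := hasDerivWithinAt_localFlow hZ T (coeConfig_mem_closedBall U) ht
  have habs : |t| ≤ (T : ℝ) + 1 := (abs_le.2 ⟨ht.1, ht.2⟩).trans (le_add_of_nonneg_right zero_le_one)
  rw [← coeConfig_localFlowSU hZ T U t ht, vfCutZ_coeConfig Z habs] at h
  convert h using 1
  funext e
  rw [vfZ_coeConfig hZt, coeConfig_localFlowSU]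

end FlowExistence

end Summit.Ventures.LatticeQCDFlow.TrivializingMaps
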